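import Literature.NumberTheory.GaloisRepresentations.ContinuousCohomologyIntCoefficients
import Literature.NumberTheory.GaloisRepresentations.ContinuousCohomologyIntInfRes
import Mathlib.Algebra.Module.CharacterModule
import Mathlib.Topology.Algebra.ClopenNhdofOne
import HarnessLib

/-!
# Continuous `ℚ/ℤ`-characters extend from open subgroups of abelian topological groups

Topic `NumberTheory/GaloisRepresentations`; namespace `Literature.NumberTheory.GaloisRepresentations`.
Theorems only (no definition, no named fact).  For a commutative topological group `G`, an OPEN
subgroup `H` and a continuous character `χ : H → ℚ/ℤ` (a continuous `1`-cocycle of the trivial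
discrete module `QModZCoeff`), there is a continuous character of `G` extending `χ`: `ℚ/ℤ` is an
injective `ℤ`-module (Mathlib `CharacterModule.dual_surjective_of_injective`, Baer), so `χ` extends
as an abstract homomorphism, and any such extension is continuous because it is locally constant on
the open subgroup `ker χ ≤ H ≤ G`.

* **`exists_character_extend_of_isOpen`** — Pontryagin duality, surjectivity of
  `Hom_cont(G, ℚ/ℤ) → Hom_cont(H, ℚ/ℤ)` for `H` open in `G` abelian
  (e.g. `G = G_k^ab`, or `G ≅ Ẑ` and `H = nẐ`);
* extensions are unique only up to characters of `G ⧸ H` (not claimed).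

Relation to the tree: `Literature/Topology/Algebra/CircleCharacterExtension.lean` proves the analogous
extension for `Circle`-valued (`ℝ/ℤ`) characters of open subgroups
(`exists_continuous_circleChar_extension_of_isOpen`); here the values stay in `ℚ/ℤ` (the tree's
discrete coefficient object `QModZCoeff` of continuous cohomology), which an `ℝ/ℤ`-valued extension
need not do, and the statement is phrased for the `contOneCocycles` of `ContinuousCohomology*`.

Honest framing: classical; nothing here bears on abc or takes a side on [IUTchIII] Cor. 3.12.

## References
* L. S. Pontryagin duality, e.g. Hewitt–Ross *Abstract Harmonic Analysis* I (24.12); J.-P. Serre,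
  *Local Fields* (1979), XIII §1 (characters of profinite abelian groups). [SerreLocalFields1979]
-/

noncomputable section

open CategoryTheory Function
open scoped Pointwise

universe u

namespace Literature.NumberTheory.GaloisRepresentations

open _root_.TopRep _root_.ContRepresentation _root_.ContinuousCohomology _root_.Topology

section Extend

variable {G : Type u} [CommGroup G] [TopologicalSpace G] [IsTopologicalGroup G]

/-- **A continuous `ℚ/ℤ`-character of an open subgroup of an abelian topological group extends to
the whole group.** [cite: SerreLocalFields1979, XIII §1] -/
theorem exists_character_extend_of_isOpen (H : Subgroup G) (hH : IsOpen (H : Set G))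
    (χ : contOneCocycles (ContinuousRep.trivial H ℤ QModZCoeff.{u}).toTopRep) :
    ∃ χ' : contOneCocycles (ContinuousRep.trivial G ℤ QModZCoeff.{u}).toTopRep,
      ∀ h : H, χ'.1 (h : G) = χ.1 h := by
  -- `χ` as a character of the additive group `Additive H`
  let c₁ : CharacterModule (Additive H) :=
    { toFun := fun a => (χ.1 (Additive.toMul a)).down
      map_zero' := by
        change (χ.1 1).down = 0
        rw [contOneCocycles.apply_one]; rfl
      map_add' := fun a b => by
        change (χ.1 (Additive.toMul a * Additive.toMul b)).down = _
        rw [contOneCocycles.apply_mul_of_trivial (fun _ _ => rfl)]; rfl }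
  -- the inclusion `Additive H ↪ Additive G`, `ℤ`-linear
  let i : Additive H →ₗ[ℤ] Additive G :=
    (AddMonoidHom.mk' (fun a : Additive H => Additive.ofMul ((Additive.toMul a : H) : G))
      (fun _ _ => rfl)).toIntLinearMap
  have hi : Function.Injective i := fun a b hab => by
    apply Additive.toMul.injective
    apply Subtype.ext
    exact Additive.ofMul.injective hab
  -- Baer: `ℚ/ℤ` is injective, so `c₁` extends along `i`
  obtain ⟨c₂, hc₂⟩ := CharacterModule.dual_surjective_of_injective i hi c₁
  have hval : ∀ h : H, c₂ (Additive.ofMul (h : G)) = (χ.1 h).down := fun h =>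
    congrArg (fun L : CharacterModule (Additive H) => L (Additive.ofMul h)) hc₂
  -- the extension as a homomorphism `G →* Multiplicative ℚ/ℤ`; continuity at `1` from the open kernel
  let φ : G →* Multiplicative QModZCoeff.{u} :=
    { toFun := fun g => Multiplicative.ofAdd (ULift.up (c₂ (Additive.ofMul g)))
      map_one' := by rw [ofMul_one, map_zero]; rfl
      map_mul' := fun a b => by rw [ofMul_mul, map_add]; rfl }
  have hV : IsOpen (((↑) : H → G) '' (oneCocycleKer χ : Set H)) :=
    hH.isOpenMap_subtype_val _ (isOpen_oneCocycleKer χ)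
  have h1 : ContinuousAt φ 1 := by
    rw [ContinuousAt, nhds_discrete (Multiplicative QModZCoeff.{u}), Filter.tendsto_pure]
    filter_upwards [hV.mem_nhds ⟨1, (oneCocycleKer χ).one_mem, rfl⟩] with x hx
    obtain ⟨h, hh, rfl⟩ := hx
    rw [map_one]
    change Multiplicative.ofAdd (ULift.up (c₂ (Additive.ofMul (h : G)))) = 1
    rw [hval h, (mem_oneCocycleKer_iff χ h).mp hh]
    rfl
  have hφ : Continuous φ := continuous_of_continuousAt_one φ h1
  refine ⟨⟨⟨fun g => ULift.up (c₂ (Additive.ofMul g)), (continuous_toAdd.comp hφ).congr fun _ => rfl⟩,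
    fun a b => ?_⟩, fun h => ?_⟩
  · change ULift.up (c₂ (Additive.ofMul (a * b))) =
      ULift.up (c₂ (Additive.ofMul a)) + ULift.up (c₂ (Additive.ofMul b))
    rw [ofMul_mul, map_add]
    rfl
  · change ULift.up (c₂ (Additive.ofMul (h : G))) = χ.1 h
    rw [hval h]
    exact ULift.up_down _

/-- **Surjectivity of restriction `Hom_cont(G, ℚ/ℤ) → Hom_cont(H, ℚ/ℤ)`** for an open subgroup `H`
of an abelian topological group `G`, in terms of the pull-back of `1`-cocycles along the inclusion.
[cite: SerreLocalFields1979, XIII §1] -/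
theorem pullback_subgroupIncl_character_surjective (H : Subgroup G) (hH : IsOpen (H : Set G)) :
    Function.Surjective fun χ' : contOneCocycles (ContinuousRep.trivial G ℤ QModZCoeff.{u}).toTopRep =>
      (contOneCocycles.pullback (subgroupIncl H)
        (𝟙 ((ContinuousRep.trivial H ℤ QModZCoeff.{u}).toTopRep)) χ' :
          contOneCocycles (ContinuousRep.trivial H ℤ QModZCoeff.{u}).toTopRep) := by
  intro χ
  obtain ⟨χ', hχ'⟩ := exists_character_extend_of_isOpen H hH χ
  exact ⟨χ', Subtype.ext (ContinuousMap.ext fun h => hχ' h)⟩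

end Extend

/-! ### Closed subgroups of profinite abelian groups are dually embedded -/

section Profinite

variable {G : Type u} [CommGroup G] [TopologicalSpace G] [IsTopologicalGroup G] [CompactSpace G]
  [TotallyDisconnectedSpace G]

/-- **A continuous `ℚ/ℤ`-character of ANY subgroup `N` of a profinite abelian group `G` extends to
`G`** (Pontryagin duality, Hewitt–Ross (24.12), for profinite abelian groups; no closedness needed
since `ℚ/ℤ` is discrete): `ker χ ⊇ N ∩ U` for an open subgroup `U`
(`ProfiniteGrp.exist_openNormalSubgroup_sub_open_nhds_of_one`), `χ` induces a character of
`N/(N ∩ U) ≅ (N·U)/U` (second isomorphism theorem), i.e. a continuous character of the OPEN subgroup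
`N·U` killing `U`, which extends to `G` by `exists_character_extend_of_isOpen`.
[cite: SerreLocalFields1979, XIII §1] -/
theorem exists_character_extend_of_profinite (N : Subgroup G)
    (χ : contOneCocycles (ContinuousRep.trivial N ℤ QModZCoeff.{u}).toTopRep) :
    ∃ χ' : contOneCocycles (ContinuousRep.trivial G ℤ QModZCoeff.{u}).toTopRep,
      ∀ n : N, χ'.1 (n : G) = χ.1 n := by
  -- Step 1: an open subgroup `U` of `G` with `N ∩ U ≤ ker χ`
  obtain ⟨W, hW, hWk⟩ := isOpen_induced_iff.mp (isOpen_oneCocycleKer χ)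
  have h1W : (1 : G) ∈ W := by
    have h1 : (1 : N) ∈ ((↑) : N → G) ⁻¹' W := by
      rw [hWk]; exact (oneCocycleKer χ).one_mem
    exact h1
  obtain ⟨U, hU⟩ := ProfiniteGrp.exist_openNormalSubgroup_sub_open_nhds_of_one hW h1W
  have hNU : ∀ n : N, (n : G) ∈ (U : Subgroup G) → χ.1 n = 0 := fun n hn => by
    have hn' : n ∈ ((↑) : N → G) ⁻¹' W := hU hn
    rw [hWk] at hn'
    exact (mem_oneCocycleKer_iff χ n).mp hn'
  -- Step 2: `χ` as a character of `N ⧸ (N ∩ U)`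
  let φ : N →* Multiplicative QModZCoeff.{u} :=
    { toFun := fun n => Multiplicative.ofAdd (χ.1 n)
      map_one' := by rw [contOneCocycles.apply_one]; rfl
      map_mul' := fun a b => by
        rw [contOneCocycles.apply_mul_of_trivial (fun _ _ => rfl)]; rfl }
  have hker : (U : Subgroup G).subgroupOf N ≤ φ.ker := fun n hn => by
    rw [MonoidHom.mem_ker]
    change Multiplicative.ofAdd (χ.1 n) = 1
    rw [hNU n (Subgroup.mem_subgroupOf.mp hn)]; rfl
  let χbar : N ⧸ (U : Subgroup G).subgroupOf N →* Multiplicative QModZCoeff.{u} :=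
    QuotientGroup.lift _ φ hker
  -- Step 3: the character `ψ` of the open subgroup `M = N ⊔ U`, through `N/(N ∩ U) ≅ M/U`
  set M : Subgroup G := N ⊔ (U : Subgroup G) with hM
  have hMopen : IsOpen (M : Set G) := Subgroup.isOpen_mono le_sup_right U.isOpen'
  let e := QuotientGroup.quotientInfEquivProdNormalQuotient N (U : Subgroup G)
  let ψ : M →* Multiplicative QModZCoeff.{u} :=
    (χbar.comp e.symm.toMonoidHom).comp (QuotientGroup.mk' (((U : Subgroup G)).subgroupOf M))
  have hψN : ∀ n : N, ψ (Subgroup.inclusion le_sup_left n) = Multiplicative.ofAdd (χ.1 n) := fun n => by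
    change χbar (e.symm (QuotientGroup.mk (Subgroup.inclusion le_sup_left n))) = _
    have he : e (QuotientGroup.mk n) = QuotientGroup.mk (Subgroup.inclusion le_sup_left n) := rfl
    rw [← he, MulEquiv.symm_apply_apply]
    rfl
  have hψU : ∀ m : M, (m : G) ∈ (U : Subgroup G) → ψ m = 1 := fun m hm => by
    change χbar (e.symm (QuotientGroup.mk m)) = 1
    have h0 : (QuotientGroup.mk m : M ⧸ (U : Subgroup G).subgroupOf M) = 1 :=
      (QuotientGroup.eq_one_iff m).mpr (Subgroup.mem_subgroupOf.mpr hm)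
    rw [h0, map_one, map_one]
  have hψcont : Continuous ψ := by
    apply continuous_of_continuousAt_one ψ
    rw [ContinuousAt, nhds_discrete (Multiplicative QModZCoeff.{u}), Filter.tendsto_pure, map_one]
    have hUM : IsOpen (((↑) : M → G) ⁻¹' (U : Set G)) := U.isOpen'.preimage continuous_subtype_val
    filter_upwards [hUM.mem_nhds (show ((1 : M) : G) ∈ (U : Set G) from (U : Subgroup G).one_mem)]
      with m hm
    exact hψU m hm
  let χM : contOneCocycles (ContinuousRep.trivial M ℤ QModZCoeff.{u}).toTopRep :=
    ⟨⟨fun m => Multiplicative.toAdd (ψ m), continuous_toAdd.comp hψcont⟩, fun a b => by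
      change Multiplicative.toAdd (ψ (a * b)) = Multiplicative.toAdd (ψ a) +
        (ContinuousRep.trivial M ℤ QModZCoeff.{u}).toTopRep.ρ a (Multiplicative.toAdd (ψ b))
      rw [map_mul, toAdd_mul]
      rfl⟩
  -- Step 4: extend from the open subgroup `M` to `G`
  obtain ⟨χ', hχ'⟩ := exists_character_extend_of_isOpen M hMopen χM
  refine ⟨χ', fun n => ?_⟩
  have h := hχ' (Subgroup.inclusion le_sup_left n)
  change χ'.1 (n : G) = Multiplicative.toAdd (ψ (Subgroup.inclusion le_sup_left n)) at h
  rw [h, hψN n]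
  rfl

/-- **Restriction `Hom_cont(G, ℚ/ℤ) → Hom_cont(N, ℚ/ℤ)` is surjective** for every subgroup `N` of a
profinite abelian group `G` (dual of the injectivity of `N ↪ G`: profinite abelian groups are
"dually embedded"). [cite: SerreLocalFields1979, XIII §1] -/
theorem pullback_subgroupIncl_character_surjective_of_profinite (N : Subgroup G) :
    Function.Surjective fun χ' : contOneCocycles (ContinuousRep.trivial G ℤ QModZCoeff.{u}).toTopRep =>
      (contOneCocycles.pullback (subgroupIncl N)
        (𝟙 ((ContinuousRep.trivial N ℤ QModZCoeff.{u}).toTopRep)) χ' :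
          contOneCocycles (ContinuousRep.trivial N ℤ QModZCoeff.{u}).toTopRep) := by
  intro χ
  obtain ⟨χ', hχ'⟩ := exists_character_extend_of_profinite N χ
  exact ⟨χ', Subtype.ext (ContinuousMap.ext fun n => hχ' n)⟩

end Profinite

/-! ### Closed subgroups of profinite abelian groups are dually closed -/

section DuallyClosed

variable {G : Type u} [CommGroup G] [TopologicalSpace G] [IsTopologicalGroup G] [CompactSpace G]
  [TotallyDisconnectedSpace G]

/-- **Closed subgroups of a profinite abelian group are dually closed**: for `N` closed and `g ∉ N`
there is a continuous character `χ : G → ℚ/ℤ` vanishing on `N` with `χ(g) ≠ 0` (an open subgroup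
`U` with `gU ∩ N = ∅` gives the finite discrete quotient `G ⧸ (U ⊔ N)` in which `ḡ ≠ 0`; Mathlib
`CharacterModule.exists_character_apply_ne_zero_of_ne_zero`). With
`exists_character_extend_of_profinite` (dually embedded) this is Pontryagin duality for subgroups of
profinite abelian groups (Hewitt–Ross (24.12); Banaszczyk (1.8)). [cite: SerreLocalFields1979, XIII §1] -/
theorem exists_character_trivialOn_apply_ne_zero (N : Subgroup G) (hN : IsClosed (N : Set G))
    {g : G} (hg : g ∉ N) :
    ∃ χ : contOneCocycles (ContinuousRep.trivial G ℤ QModZCoeff.{u}).toTopRep,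
      (∀ n ∈ N, χ.1 n = 0) ∧ χ.1 g ≠ 0 := by
  -- an open subgroup `U` with `U g ∩ N = ∅`
  have hVopen : IsOpen ((fun u : G => u * g) ⁻¹' ((N : Set G)ᶜ)) :=
    hN.isOpen_compl.preimage (continuous_id.mul continuous_const)
  have h1V : (1 : G) ∈ (fun u : G => u * g) ⁻¹' ((N : Set G)ᶜ) := by
    rw [Set.mem_preimage, one_mul]; exact hg
  obtain ⟨U, hU⟩ := ProfiniteGrp.exist_openNormalSubgroup_sub_open_nhds_of_one hVopen h1V
  set H : Subgroup G := (U : Subgroup G) ⊔ N with hH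
  have hHopen : IsOpen (H : Set G) := Subgroup.isOpen_mono le_sup_left U.isOpen'
  have hgH : g ∉ H := by
    intro hmem
    have hmem' : g ∈ ((U : Subgroup G) : Set G) * (N : Set G) := by
      rw [← Subgroup.mul_normal]; exact hmem
    obtain ⟨u, hu, c, hc, huc⟩ := hmem'
    have hu' : u⁻¹ ∈ (fun u : G => u * g) ⁻¹' ((N : Set G)ᶜ) := hU (U.inv_mem' hu)
    rw [Set.mem_preimage, Set.mem_compl_iff] at hu'
    apply hu'
    have : u⁻¹ * g = c := by rw [← huc, inv_mul_cancel_left]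
    rw [this]; exact hc
  -- the finite discrete abelian quotient `G ⧸ H`
  haveI : DiscreteTopology (G ⧸ H) := QuotientGroup.discreteTopology hHopen
  have hne : Additive.ofMul (QuotientGroup.mk g : G ⧸ H) ≠ 0 := by
    intro h0
    apply hgH
    rw [← QuotientGroup.eq_one_iff]
    exact Additive.ofMul.injective h0
  obtain ⟨c, hc⟩ := CharacterModule.exists_character_apply_ne_zero_of_ne_zero hne
  refine ⟨⟨⟨fun x => ULift.up (c (Additive.ofMul (QuotientGroup.mk x : G ⧸ H))), by
      exact (continuous_of_discreteTopology (β := QModZCoeff.{u})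
        (f := fun q : G ⧸ H => ULift.up (c (Additive.ofMul q)))).comp
          (QuotientGroup.continuous_mk (N := H))⟩, fun a b => ?_⟩, fun n hn => ?_, ?_⟩
  · change ULift.up (c (Additive.ofMul (QuotientGroup.mk (a * b) : G ⧸ H))) =
      ULift.up (c (Additive.ofMul (QuotientGroup.mk a : G ⧸ H))) +
        ULift.up (c (Additive.ofMul (QuotientGroup.mk b : G ⧸ H)))
    rw [QuotientGroup.mk_mul, ofMul_mul, map_add]
    rfl
  · change ULift.up (c (Additive.ofMul (QuotientGroup.mk n : G ⧸ H))) = 0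
    rw [(QuotientGroup.eq_one_iff n).mpr (le_sup_right (a := (U : Subgroup G)) hn), ofMul_one,
      map_zero]
    rfl
  · intro h0
    exact hc (congrArg ULift.down h0)

/-- **A closed subgroup of a profinite abelian group is the common kernel of the characters
vanishing on it**: `g ∈ N ↔ χ(g) = 0` for every continuous `χ : G → ℚ/ℤ` with `χ|_N = 0`.
[cite: SerreLocalFields1979, XIII §1] -/
theorem mem_iff_forall_character_trivialOn (N : Subgroup G) (hN : IsClosed (N : Set G)) (g : G) :
    g ∈ N ↔ ∀ χ : contOneCocycles (ContinuousRep.trivial G ℤ QModZCoeff.{u}).toTopRep,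
      (∀ n ∈ N, χ.1 n = 0) → χ.1 g = 0 :=
  ⟨fun hg _ hχ => hχ g hg, fun h => by_contra fun hg =>
    (exists_character_trivialOn_apply_ne_zero N hN hg).elim fun χ hχ => hχ.2 (h χ hχ.1)⟩

end DuallyClosed

/-! ### The dual short exact sequence `0 → (G/N)^∨ → G^∨ → N^∨ → 0` -/

section DualSES

variable {G : Type u} [CommGroup G] [TopologicalSpace G] [IsTopologicalGroup G] [CompactSpace G]
  [TotallyDisconnectedSpace G] (N : Subgroup G)

/-- **Pontryagin duality for `N ≤ G` profinite abelian, as a short exact sequence of continuous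
`ℚ/ℤ`-duals `0 → Hom(G/N) → Hom(G) → Hom(N) → 0`**: inflation along `G → G/N` is injective,
its image is the kernel of restriction to `N` (`exists_character_pullback_quotientMk_eq_iff`), and
restriction is surjective (`exists_character_extend_of_profinite`).
[cite: SerreLocalFields1979, XIII §1] -/
theorem character_inf_res_shortExact :
    Injective (fun ψ : contOneCocycles (ContinuousRep.trivial (G ⧸ N) ℤ QModZCoeff.{u}).toTopRep =>
        (contOneCocycles.pullback (ContinuousMonoidHom.quotientMk N)
          (𝟙 ((ContinuousRep.trivial G ℤ QModZCoeff.{u}).toTopRep)) ψ :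
            contOneCocycles (ContinuousRep.trivial G ℤ QModZCoeff.{u}).toTopRep)) ∧
    Function.Exact
      (fun ψ : contOneCocycles (ContinuousRep.trivial (G ⧸ N) ℤ QModZCoeff.{u}).toTopRep =>
        (contOneCocycles.pullback (ContinuousMonoidHom.quotientMk N)
          (𝟙 ((ContinuousRep.trivial G ℤ QModZCoeff.{u}).toTopRep)) ψ :
            contOneCocycles (ContinuousRep.trivial G ℤ QModZCoeff.{u}).toTopRep))
      (fun χ' : contOneCocycles (ContinuousRep.trivial G ℤ QModZCoeff.{u}).toTopRep =>
        (contOneCocycles.pullback (subgroupIncl N)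
          (𝟙 ((ContinuousRep.trivial N ℤ QModZCoeff.{u}).toTopRep)) χ' :
            contOneCocycles (ContinuousRep.trivial N ℤ QModZCoeff.{u}).toTopRep)) ∧
    Surjective (fun χ' : contOneCocycles (ContinuousRep.trivial G ℤ QModZCoeff.{u}).toTopRep =>
        (contOneCocycles.pullback (subgroupIncl N)
          (𝟙 ((ContinuousRep.trivial N ℤ QModZCoeff.{u}).toTopRep)) χ' :
            contOneCocycles (ContinuousRep.trivial N ℤ QModZCoeff.{u}).toTopRep)) := by
  refine ⟨fun ψ ψ' h => character_quotient_unique N ψ ψ' fun g => ?_, fun χ => ?_,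
    pullback_subgroupIncl_character_surjective_of_profinite N⟩
  · exact congrArg (fun χ : contOneCocycles (ContinuousRep.trivial G ℤ QModZCoeff.{u}).toTopRep =>
      χ.1 g) h
  · -- `res χ = 0 ↔ χ|_N = 0 ↔ χ` is inflated
    rw [Set.mem_range, exists_character_pullback_quotientMk_eq_iff]
    constructor
    · intro h n hn
      exact congrArg (fun φ : contOneCocycles (ContinuousRep.trivial N ℤ QModZCoeff.{u}).toTopRep =>
        φ.1 ⟨n, hn⟩) h
    · intro h
      exact Subtype.ext (ContinuousMap.ext fun n => h n n.2)

end DualSES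

end Literature.NumberTheory.GaloisRepresentations

end
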